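import Summits.QuantumFields.BalabanUV.T4Continuum.Support.NE7HessianFloorModGauge
import HarnessLib

/-!
# NE7BorderedFloorAssembly — THE LOGICAL SHAPE OF THE (G′) ASSEMBLY: a variational minimum `m₂ = min {w·H X − Λ X : Q X = v}` (the bordered Hessian of the constrained minimal action,
# ✓ `NE7MinActHessianHessForm.minAct_hessian_hessForm_allData`) is bounded below by `(1−γ)·w·(E − β)∕α − δ` as soon as a REPRESENTATIVE SYSTEM `S` (i) is REACHED from every fibre element
# without changing `w·H − Λ` (corner-trivial gauge directions: this gen's G3∕G4 + row NE7b's ✓ `borderedForm_add_gaugeDir`), (ii) carries the HESSIAN FLOOR `E ≤ α·H X′ + β` (this gen's G4: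
# `E = Σ_P nhs(curl_{V₀}ṽ)`, `α = (1+θ) + 2K·4C_P·n`, `β = 2K(2liftMassC + 4C_P liftCurlC)‖ṽ‖²`) and (iii) carries a MULTIPLIER LETTER `|Λ X′| ≤ γ·w·H X′ + δ` (open: row NE7b's (G3) on the
# hierarchical representative, this gen's G6 bookkeeping) (lineage `b2b-balaban-t4-ne7-p1`, gen 118, file G7; memo ROAD-G118 §3(c)∕§5)

Cell `pub-balaban`, rung (B)+1 sub-cell t4, CRUX PROVER NE7 #1 (OWNER of row NE7), generation 118.  Pure order∕real reasoning ([folklore]; 0 def, 0 sorry): the socket both teams discharge.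
* `hess_ge_of_floor` — `E ≤ α·h + β`, `0 < α` ⟹ `(E − β)∕α ≤ h`;
* **`isLeast_bordered_lower_bound`** — the displayed shape, for arbitrary types `ι` (fine fields), `κ` (coarse data), `Q : ι → κ`, `H Λ : ι → ℝ`, `w ≥ 0`, `γ ≤ 1`, `α > 0`;
* `bordered_lower_bound_of_mem` — the same conclusion for EVERY element of the constrained set (not only the least one): `∀ X, Q X = v → (1−γ)·w·(E−β)∕α − δ ≤ w·H X − Λ X`.
HONEST FRAMING: no analytic content; (i) for the multi-level slice is G4 + row NE7b's (D), (ii) is G4, (iii) is OPEN (ROAD-G118 §3); nothing of Bałaban's asserted; NOT (G′), NOT NE7 as a spine node;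
spine 0∕9; finite T⁴ rung (B)+1 — NOT infinite volume, NOT mass gap, NOT BetaPertH, NOT Clay.
-/

set_option autoImplicit false

namespace Summit.QuantumFields.BalabanUV.T4Continuum.NE7BorderedFloorAssembly

/-- `E ≤ α·h + β`, `0 < α` ⟹ `(E − β)∕α ≤ h`. [folklore] -/
theorem hess_ge_of_floor {E α β h : ℝ} (hα : 0 < α) (hfloor : E ≤ α * h + β) : (E - β) / α ≤ h := by
  rw [div_le_iff₀ hα]
  linarith

/-- **THE (G′) ASSEMBLY SHAPE ON EVERY CONSTRAINED ELEMENT**: if every `X` with `Q X = v` reaches some `X′ ∈ S` with `Q X′ = v` and the same bordered value `w·H − Λ`, and on `S ∩ {Q = v}` the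
floor `E ≤ α·H X′ + β` and the multiplier letter `|Λ X′| ≤ γ·(w·H X′) + δ` hold (`0 < α`, `0 ≤ w`, `γ ≤ 1`), then `(1−γ)·w·((E−β)∕α) − δ ≤ w·H X − Λ X` for every `X` with `Q X = v`. [folklore] -/
theorem bordered_lower_bound_of_mem {ι κ : Type*} {Q : ι → κ} {v : κ} {w : ℝ} {H Λ : ι → ℝ} (S : Set ι)
    (hreach : ∀ X : ι, Q X = v → ∃ X' ∈ S, Q X' = v ∧ w * H X' - Λ X' = w * H X - Λ X)
    {E α β γ δ : ℝ} (hα : 0 < α) (hw : 0 ≤ w) (hγ : γ ≤ 1)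
    (hfloor : ∀ X' ∈ S, Q X' = v → E ≤ α * H X' + β) (hmult : ∀ X' ∈ S, Q X' = v → |Λ X'| ≤ γ * (w * H X') + δ)
    (X : ι) (hX : Q X = v) : (1 - γ) * w * ((E - β) / α) - δ ≤ w * H X - Λ X := by
  obtain ⟨X', hX'S, hQX', hval⟩ := hreach X hX
  rw [← hval]
  have h1 : (E - β) / α ≤ H X' := hess_ge_of_floor hα (hfloor X' hX'S hQX')
  have h2 : Λ X' ≤ γ * (w * H X') + δ := (le_abs_self _).trans (hmult X' hX'S hQX')
  have h3 : (1 - γ) * w * ((E - β) / α) ≤ (1 - γ) * w * H X' := mul_le_mul_of_nonneg_left h1 (mul_nonneg (by linarith) hw)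
  nlinarith

/-- **THE (G′) ASSEMBLY SHAPE FOR THE BORDERED HESSIAN** (the least constrained value, as in ✓ `minAct_hessian_hessForm_allData`): under the hypotheses of `bordered_lower_bound_of_mem`,
`IsLeast {q | ∃ X, Q X = v ∧ q = w·H X − Λ X} m₂ ⟹ (1−γ)·w·((E−β)∕α) − δ ≤ m₂`. [folklore] -/
theorem isLeast_bordered_lower_bound {ι κ : Type*} {Q : ι → κ} {v : κ} {w : ℝ} {H Λ : ι → ℝ} {m₂ : ℝ}
    (hleast : IsLeast {q : ℝ | ∃ X : ι, Q X = v ∧ q = w * H X - Λ X} m₂) (S : Set ι)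
    (hreach : ∀ X : ι, Q X = v → ∃ X' ∈ S, Q X' = v ∧ w * H X' - Λ X' = w * H X - Λ X)
    {E α β γ δ : ℝ} (hα : 0 < α) (hw : 0 ≤ w) (hγ : γ ≤ 1)
    (hfloor : ∀ X' ∈ S, Q X' = v → E ≤ α * H X' + β) (hmult : ∀ X' ∈ S, Q X' = v → |Λ X'| ≤ γ * (w * H X') + δ) :
    (1 - γ) * w * ((E - β) / α) - δ ≤ m₂ := by
  obtain ⟨⟨X₀, hQ₀, hm₂⟩, -⟩ := hleast
  rw [hm₂]
  exact bordered_lower_bound_of_mem S hreach hα hw hγ hfloor hmult X₀ hQ₀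

end Summit.QuantumFields.BalabanUV.T4Continuum.NE7BorderedFloorAssembly
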